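import Summits.AtomisticToContinuum.Crystallization.Theses.HcpDefectCounting
import Summits.AtomisticToContinuum.Crystallization.Theorems.PricedLinkCensusStackingHingeLjRegistryDomination
import Summits.AtomisticToContinuum.Crystallization.Theorems.PricedLinkCensusStackingHingeBarlowEnergyIdentification
import Summits.AtomisticToContinuum.Crystallization.Theorems.PricedLinkCensusStackingHingeHcpEnergyMinOnBox
import Summits.AtomisticToContinuum.Crystallization.Theorems.MinMeanCycleStackingLockHaggEnergyPeriodic

/-!
# Birth skeleton — crux `HcpDefectCounting.HcpBulkFloor` (item stmt-AtomisticToContinuum-14477)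

The crux (rank 3 of route `HcpDefectCounting`, K_E = "the finite bulk floor at hcp"): there are
`a, h ≠ 0` in the box `B = {47/50 ≤ a ≤ 1, 39/50·a ≤ h ≤ 17/20·a}` such that
`N · e_LJ(hcpPeriodicConfiguration ha hh) ≤ 𝓔_LJ(x)` for EVERY `N` and every injective
`x : Fin N → ℝ³` — energetic crystallization onto relaxed hcp in its sharp finite form.

## Where the content sits (why the cut goes one level into item 3061)

The finite-to-periodic half of the crux is ALREADY A THEOREM of the tree:
`Theorems.ChargedEnergyGapNegative.card_mul_eStar_le : Injective x → N · e* ≤ 𝓔_LJ(x)` with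
`e* = ⨅_Q e_LJ(Q)` (periodisation of a finite cluster with a large cubic period, cross-cell pairs at
distance `> 1` where `V_LJ < 0`; module `Theorems.ChargedEnergyGap.Negative.Unconditional`, imported by
the route file through `Theorems.ExcessDecayLiouvilleCrysEnergyLimit`).  Hence
`HcpPeriodicMinimiser → HcpBulkFloor` is proved below in four lines
(`hcpBulkFloor_of_hcpPeriodicMinimiser`: `IsLeast.csInf_eq` identifies `e*` with `e(hcp a h)`), the
route's glue item `MinimiserGivesFloor` (stmt-14480) is a corollary (`minimiserGivesFloor`), and the
crux is exactly as hard as the shared periodic-minimiser item stmt-AtomisticToContinuum-3061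
(`HcpPeriodicMinimiser`, this route's support copy).  A two-stub cut "3061 + floor lemma" would have ONE
load-bearing open stub (the floor lemma is landed), i.e. a restatement; so the skeleton cuts THROUGH
3061 along the dimension split already registered for it
(`Cruxes/HcpPeriodicMinimiser/Lines/birth.lean`, same two stubs, stated verbatim = the same ledger
items, so provers of either crux work the same pieces):

* `stub_periodicReductionToBarlow` — (R, 3-D, open, XL) verbatim the shared crux
  `PoissonBesselStacking.PeriodicReductionToBarlow` (item stmt-AtomisticToContinuum-3062; registered
  lines `Cruxes/PeriodicReductionToBarlow/Lines/{birth,layered_seam}.lean`): every periodic `Q` is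
  matched at no higher LJ energy per particle by a UNIFORM periodic Barlow stacking
  `barlowPeriodicConfiguration s ha hh hp hs` with `(a, h) ∈ B`.
* `stub_dominatedRegistrySelectsHcp` — (S, 1-D, provable now, S–M) verbatim the support item
  `OneCrossingRisingSea.DominatedRegistrySelectsHcp` (item stmt-AtomisticToContinuum-12054): for every
  coupling sequence `J` with `Σ k|J_k| < ∞` and `J₂ + Σ_{k≥3}(k−1)|J_k| ≤ 0` the alternating Hägg word
  (hcp) minimises the stacking energy density `haggStackingEnergy J` over all Hägg words (finite-volume
  core = the landed `HaggDominationAllRanges`, item 0737; divide by `n`, take `liminf`).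

## Assembly (sorry-free; concludes `HcpDefectCounting.HcpBulkFloor` BY NAME)

`hcpPeriodicMinimiser_of_stubs : (R) → (S) → HcpDefectCounting.HcpPeriodicMinimiser` — the chain of
`Cruxes/HcpPeriodicMinimiser/Lines/birth.lean` re-typed on this route's copy of 3061: box minimiser
`(a₀, h₀)` of the relaxed-hcp energy (LANDED item 3066, `PricedHcpWindowsHcpBox.stub_hcpEnergyMinOnBox`);
for a competitor `Q`, (R) gives a box Barlow stacking below `Q`; the LANDED certified registry numerics
(item 3063, `PricedHcpWindowsLjRegistry.stub_ljRegistryDomination`: `J₂ < 0`,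
`Σ_{k≥3}(k−1)|J_k| ≤ |J₂|/2`) feed (S) with `J = barlowCoupling lennardJones a h`; periodic averaging
(LANDED `Theorems.tendsto_haggEnergy_div`), `haggStackingEnergy_alternating` and the LANDED layer
identification (item 3065, `PricedHcpWindowsBarlowEnergy.stub_barlowEnergyIdentification`) turn
`h(J, alt) ≤ h(J, s)` into `e(hcp a h) ≤ e(barlow a h s)`; chain
`e(hcp a₀ h₀) ≤ e(hcp a h) ≤ e(barlow a h s) ≤ e(Q)`.
Then `HcpBulkFloor_of := hcpBulkFloor_of_hcpPeriodicMinimiser ∘ hcpPeriodicMinimiser_of_stubs`.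

Sorries: exactly the two stubs.  BC3 probes (`stub → HcpBulkFloor`, `stub → Crystallization` by
`first | exact? | simpa | aesop`, plus the unfolded-`Crystallization` variant): all FAIL (seat folder
`bc/`, NOTES.md).  Stub (R) is a CONSEQUENCE of the crux on paper (take the hcp minimiser itself,
`s` alternating, `p = 2`) and is used toward it; stub (S) is not (general `J`).  Disproof used: none
on file for this crux (`ledger crux ls`: no `Disproof.lean`); the refuter's mutation
`not_hcpBulkFloor_nonInjective` (evidence `Mutation.lean` on 14477: the floor WITHOUT `Injective x` is
false) is honoured — injectivity enters exactly at `card_mul_eStar_le hx`.  Negatives index: no refuted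
statement of `AtomisticToContinuum` is an instance of either stub.
-/

namespace Summit.AtomisticToContinuum.Crystallization.Cruxes.HcpBulkFloor.Birth

open Literature.MathematicalPhysics.StatisticalMechanics

/-- **Stub (R) — reduction of the periodic problem to uniform Barlow stackings in the box**
(verbatim the shared crux `PoissonBesselStacking.PeriodicReductionToBarlow`, item
stmt-AtomisticToContinuum-3062): for every periodic configuration `Q` of `ℝ³` there are
`(a, h) ∈ B` and a `p`-periodic Hägg word `s` such that the uniform Barlow stacking
`barlowPeriodicConfiguration s ha hh hp hs` has Lennard-Jones energy per particle `≤` that of `Q`.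
Open (Blanc–Lewin 2015 §2.3: layering of near-optimal periodic `Q` + hole locking + spacing
convexity); XL. -/
theorem stub_periodicReductionToBarlow : ∀ Q : Literature.MathematicalPhysics.StatisticalMechanics.PeriodicConfiguration 3, ∃ a h : ℝ, 47 / 50 ≤ a ∧ a ≤ 1 ∧ 39 / 50 * a ≤ h ∧ h ≤ 17 / 20 * a ∧ ∃ (s : ℤ → ℤ) (p : ℕ) (ha : a ≠ 0) (hh : h ≠ 0) (hp : p ≠ 0) (hs : ∀ i, s (i + p) = s i), Literature.MathematicalPhysics.StatisticalMechanics.IsHaggSeq s ∧ (Literature.MathematicalPhysics.StatisticalMechanics.barlowPeriodicConfiguration s ha hh hp hs).energyPerParticle Literature.MathematicalPhysics.StatisticalMechanics.lennardJones ≤ Q.energyPerParticle Literature.MathematicalPhysics.StatisticalMechanics.lennardJones := by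
  sorry

/-- **Stub (S) — dominated registry couplings select hcp** (verbatim the support item
`OneCrossingRisingSea.DominatedRegistrySelectsHcp`, item stmt-AtomisticToContinuum-12054): for every
coupling sequence `J` with `Σ k|J_k| < ∞` and `J₂ + Σ_{k≥3}(k−1)|J_k| ≤ 0`, the alternating Hägg word
minimises `haggStackingEnergy J` over all Hägg words.  Provable now (finite-volume core = the landed
`HaggDominationAllRanges`, item 0737; divide by `n`, `liminf`, `haggStackingEnergy_alternating`); S–M. -/
theorem stub_dominatedRegistrySelectsHcp : ∀ J : ℕ → ℝ, Summable (fun k : ℕ => (k : ℝ) * |J k|) → J 2 + ∑' k : ℕ, (if 3 ≤ k then ((k : ℝ) - 1) * |J k| else 0) ≤ 0 → IsLeast (Set.range fun s : {s : ℤ → ℤ // Literature.MathematicalPhysics.StatisticalMechanics.IsHaggSeq s} => Literature.MathematicalPhysics.StatisticalMechanics.haggStackingEnergy J s.1) (Literature.MathematicalPhysics.StatisticalMechanics.haggStackingEnergy J Literature.MathematicalPhysics.StatisticalMechanics.alternatingHagg) := by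
  sorry

/-- **Assembly, periodic half**: stub (R) → stub (S) → this route's copy of the shared item 3061
`HcpDefectCounting.HcpPeriodicMinimiser`, composed with the LANDED items 3066 (box minimiser of the
relaxed-hcp energy), 3063 (sign + half-domination of the LJ registry couplings on the box), 3065 (layer
identification of the energy of a periodic Barlow stacking) and the landed periodic averaging of the
Hägg energy (the chain of `Cruxes/HcpPeriodicMinimiser/Lines/birth.lean`).  No `sorry`. -/
theorem hcpPeriodicMinimiser_of_stubs :
    (∀ Q : Literature.MathematicalPhysics.StatisticalMechanics.PeriodicConfiguration 3, ∃ a h : ℝ, 47 / 50 ≤ a ∧ a ≤ 1 ∧ 39 / 50 * a ≤ h ∧ h ≤ 17 / 20 * a ∧ ∃ (s : ℤ → ℤ) (p : ℕ) (ha : a ≠ 0) (hh : h ≠ 0) (hp : p ≠ 0) (hs : ∀ i, s (i + p) = s i), Literature.MathematicalPhysics.StatisticalMechanics.IsHaggSeq s ∧ (Literature.MathematicalPhysics.StatisticalMechanics.barlowPeriodicConfiguration s ha hh hp hs).energyPerParticle Literature.MathematicalPhysics.StatisticalMechanics.lennardJones ≤ Q.energyPerParticle Literature.MathematicalPhysics.StatisticalMechanics.lennardJones)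 →
    (∀ J : ℕ → ℝ, Summable (fun k : ℕ => (k : ℝ) * |J k|) → J 2 + ∑' k : ℕ, (if 3 ≤ k then ((k : ℝ) - 1) * |J k| else 0) ≤ 0 → IsLeast (Set.range fun s : {s : ℤ → ℤ // Literature.MathematicalPhysics.StatisticalMechanics.IsHaggSeq s} => Literature.MathematicalPhysics.StatisticalMechanics.haggStackingEnergy J s.1) (Literature.MathematicalPhysics.StatisticalMechanics.haggStackingEnergy J Literature.MathematicalPhysics.StatisticalMechanics.alternatingHagg)) →
    Summit.AtomisticToContinuum.Crystallization.Theses.HcpDefectCounting.HcpPeriodicMinimiser := by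
  intro hR hS
  -- (landed item 3066): the box minimiser (a₀, h₀) of the relaxed-hcp energy
  obtain ⟨a₀, h₀, ha₀, hh₀, hb₁, hb₂, hb₃, hb₄, hmin⟩ :=
    Summit.AtomisticToContinuum.Crystallization.Theorems.PricedHcpWindowsHcpBox.stub_hcpEnergyMinOnBox
  refine ⟨a₀, h₀, ha₀, hh₀, hb₁, hb₂, hb₃, hb₄, ⟨hcpPeriodicConfiguration ha₀ hh₀, rfl⟩, ?_⟩
  rintro _ ⟨Q, rfl⟩
  -- (R): a uniform Barlow competitor with parameters in the box below Q
  obtain ⟨a, h, hc₁, hc₂, hc₃, hc₄, s, p, ha, hh, hp, hs, hHagg, hle⟩ := hR Q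
  have ha0 : 0 < a := by linarith
  have hh0 : 0 < h := by nlinarith
  have hp_pos : 0 < p := Nat.pos_of_ne_zero hp
  -- (landed item 3063): summability, J₂ < 0 and the half-domination of the LJ couplings at (a, h)
  obtain ⟨hsum, hJ2, htail⟩ :=
    Summit.AtomisticToContinuum.Crystallization.Theorems.PricedHcpWindowsLjRegistry.stub_ljRegistryDomination
      a h hc₁ hc₂ hc₃ hc₄
  have hdomJ : barlowCoupling lennardJones a h 2 +
      ∑' k : ℕ, (if 3 ≤ k then ((k : ℝ) - 1) * |barlowCoupling lennardJones a h k| else 0) ≤ 0 := by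
    have habs : |barlowCoupling lennardJones a h 2| = -barlowCoupling lennardJones a h 2 :=
      abs_of_neg hJ2
    linarith
  -- (S): the alternating (hcp) word minimises the stacking energy density for these couplings
  have hsel : haggStackingEnergy (barlowCoupling lennardJones a h) alternatingHagg ≤
      haggStackingEnergy (barlowCoupling lennardJones a h) s :=
    (hS (barlowCoupling lennardJones a h) hsum hdomJ).2 ⟨⟨s, hHagg⟩, rfl⟩
  -- h(J, alt) = Σ'_{even} J_k;  h(J, s) = H_p/p for the p-periodic s (landed periodic averaging)
  have hper : haggStackingEnergy (barlowCoupling lennardJones a h) s =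
      haggEnergy p (barlowCoupling lennardJones a h) s / p := by
    unfold haggStackingEnergy
    exact (Summit.AtomisticToContinuum.Crystallization.Theorems.tendsto_haggEnergy_div hs _ hp_pos).liminf_eq
  have hdiv : (∑' k : ℕ, (if 2 ≤ k ∧ Even k then barlowCoupling lennardJones a h k else 0)) ≤
      haggEnergy p (barlowCoupling lennardJones a h) s / p :=
    calc (∑' k : ℕ, (if 2 ≤ k ∧ Even k then barlowCoupling lennardJones a h k else 0))
          = haggStackingEnergy (barlowCoupling lennardJones a h) alternatingHagg :=
            (haggStackingEnergy_alternating _).symm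
      _ ≤ haggStackingEnergy (barlowCoupling lennardJones a h) s := hsel
      _ = haggEnergy p (barlowCoupling lennardJones a h) s / p := hper
  -- (landed item 3065): layer identification of the competitor, and the hcp closed form
  have hEbar :=
    Summit.AtomisticToContinuum.Crystallization.Theorems.PricedHcpWindowsBarlowEnergy.stub_barlowEnergyIdentification
      a h ha0 hh0 s p ha hh hp hs hHagg
  have hEhcp :=
    Summit.AtomisticToContinuum.Crystallization.Theorems.PricedHcpWindowsHcpBox.energyPerParticle_hcp_eq
      ha0 hh0 ha hh
  -- chain: e(hcp a₀ h₀) ≤ e(hcp a h) = e₀ + Σ'_{even} J_k ≤ e₀ + H_p/p = e(barlow a h s) ≤ e(Q)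
  calc (hcpPeriodicConfiguration ha₀ hh₀).energyPerParticle lennardJones
        ≤ (hcpPeriodicConfiguration ha hh).energyPerParticle lennardJones :=
          hmin a h ha hh hc₁ hc₂ hc₃ hc₄
    _ = barlowBaseEnergy lennardJones a h +
          ∑' k : ℕ, (if 2 ≤ k ∧ Even k then barlowCoupling lennardJones a h k else 0) := hEhcp
    _ ≤ barlowBaseEnergy lennardJones a h + haggEnergy p (barlowCoupling lennardJones a h) s / p := by
          linarith
    _ = (barlowPeriodicConfiguration s ha hh hp hs).energyPerParticle lennardJones := hEbar.symm
    _ ≤ Q.energyPerParticle lennardJones := hle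

/-- **Assembly, finite half (proved; the content of the route's glue item `MinimiserGivesFloor`,
stmt-14480, without its `CrysEnergyLimit` hypothesis)**: a box hcp that is a least element of the
periodic energies is a floor for every finite injective cluster — `N · e* ≤ 𝓔_LJ(x)` is the landed
`ChargedEnergyGapNegative.card_mul_eStar_le` (periodisation, `V_LJ < 0` beyond distance `1`), and
`IsLeast.csInf_eq` identifies `e* = ⨅_Q e(Q)` with `e(hcp a h)`.  Injectivity of `x` is load-bearing
(refuter's `Mutation.lean` on 14477).  No `sorry`. -/
theorem hcpBulkFloor_of_hcpPeriodicMinimiser :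
    Summit.AtomisticToContinuum.Crystallization.Theses.HcpDefectCounting.HcpPeriodicMinimiser →
    Summit.AtomisticToContinuum.Crystallization.Theses.HcpDefectCounting.HcpBulkFloor := by
  rintro ⟨a, h, ha, hh, hb₁, hb₂, hb₃, hb₄, hleast⟩
  refine ⟨a, h, ha, hh, hb₁, hb₂, hb₃, hb₄, fun N x hx => ?_⟩
  have hfloor :=
    Summit.AtomisticToContinuum.Crystallization.Theorems.ChargedEnergyGapNegative.card_mul_eStar_le hx
  have e : Summit.AtomisticToContinuum.Crystallization.Theorems.ChargedEnergyGapNegative.eStar =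
      (hcpPeriodicConfiguration ha hh).energyPerParticle lennardJones := hleast.csInf_eq
  rw [e] at hfloor
  exact hfloor

/-- The route's glue item `MinimiserGivesFloor` (stmt-AtomisticToContinuum-14480) is a corollary (its
`CrysEnergyLimit` hypothesis is not needed).  No `sorry`. -/
theorem minimiserGivesFloor :
    Summit.AtomisticToContinuum.Crystallization.Theses.HcpDefectCounting.MinimiserGivesFloor :=
  fun hMin _ => hcpBulkFloor_of_hcpPeriodicMinimiser hMin

/-- **Assembly**: stub (R) → stub (S) → the crux `HcpDefectCounting.HcpBulkFloor`, by name — the two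
hypotheses are LITERALLY the two stub signatures.  No `sorry`. -/
theorem HcpBulkFloor_of :
    (∀ Q : Literature.MathematicalPhysics.StatisticalMechanics.PeriodicConfiguration 3, ∃ a h : ℝ, 47 / 50 ≤ a ∧ a ≤ 1 ∧ 39 / 50 * a ≤ h ∧ h ≤ 17 / 20 * a ∧ ∃ (s : ℤ → ℤ) (p : ℕ) (ha : a ≠ 0) (hh : h ≠ 0) (hp : p ≠ 0) (hs : ∀ i, s (i + p) = s i), Literature.MathematicalPhysics.StatisticalMechanics.IsHaggSeq s ∧ (Literature.MathematicalPhysics.StatisticalMechanics.barlowPeriodicConfiguration s ha hh hp hs).energyPerParticle Literature.MathematicalPhysics.StatisticalMechanics.lennardJones ≤ Q.energyPerParticle Literature.MathematicalPhysics.StatisticalMechanics.lennardJones) →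
    (∀ J : ℕ → ℝ, Summable (fun k : ℕ => (k : ℝ) * |J k|) → J 2 + ∑' k : ℕ, (if 3 ≤ k then ((k : ℝ) - 1) * |J k| else 0) ≤ 0 → IsLeast (Set.range fun s : {s : ℤ → ℤ // Literature.MathematicalPhysics.StatisticalMechanics.IsHaggSeq s} => Literature.MathematicalPhysics.StatisticalMechanics.haggStackingEnergy J s.1) (Literature.MathematicalPhysics.StatisticalMechanics.haggStackingEnergy J Literature.MathematicalPhysics.StatisticalMechanics.alternatingHagg)) →
    Summit.AtomisticToContinuum.Crystallization.Theses.HcpDefectCounting.HcpBulkFloor :=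
  fun hR hS => hcpBulkFloor_of_hcpPeriodicMinimiser (hcpPeriodicMinimiser_of_stubs hR hS)

/-- The assembly instantiated with the two stubs: the crux, modulo exactly the two `sorry`s. -/
theorem HcpBulkFloor_skeleton :
    Summit.AtomisticToContinuum.Crystallization.Theses.HcpDefectCounting.HcpBulkFloor :=
  HcpBulkFloor_of stub_periodicReductionToBarlow stub_dominatedRegistrySelectsHcp

end Summit.AtomisticToContinuum.Crystallization.Cruxes.HcpBulkFloor.Birth
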